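import Mathlib.Algebra.Order.Archimedean.Basic
import Mathlib.Algebra.Order.Archimedean.Real.Basic
import Literature.AlgebraicGeometry.Frobenioids.RlfStructureWeak
import Literature.AlgebraicGeometry.Frobenioids.RealificationRPow
import Literature.AlgebraicGeometry.Frobenioids.RealActionGroupification
import HarnessLib

/-!
# Frobenioids I, Def. 2.4 (i): the powers `a^r`, the `ℝ`-vector space `(M^rlf)^gp`, and the automatic
# `ℝ_{≥0}`-linearity of homomorphisms — for the realification of a *weakly* perf-factorial monoid

Mochizuki, *The geometry of Frobenioids I*, Kyushu J. Math. **62** (2008), §2, Definition 2.4 (i) p. 48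
("`(M^rlf)^gp ⊆ (M^rlf_factor)^gp = ∏_{𝔭 ∈ Prime(M)} (M^rlf_𝔭)^gp` [is] an `ℝ`-vector space") and §5,
Proposition 5.3 p. 103 ("the divisor monoid `Φ^rlf`", whose pull-back maps must be `ℝ`-linear for
`ℝ · Φ^birat ⊆ (Φ^rlf)^gp` to be a monoid on `D`) [cite: MochizukiFrdI2008, Def. 2.4(i) p.48]
[cite: MochizukiFrdI2008, Prop. 5.3 p.103]; used by [MochizukiEtTh2009] Def. 3.6 (i) p. 76
("`Φ₀^ℝ := Φ₀^rlf`", "the `ℝ`-vector subspace `ℝ·Φ₀^cnst ⊆ (Φ₀^ℝ)^gp`").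

WEAK-HYPOTHESIS TWIN (verbatim ports; the source `M` is only WEAKLY perf-factorial, `IsPerfFactorialWeak`,
the abc-iut cell's named weakening (a)(b)(c)+(d_ord)+(d_res) of Def. 2.4 (i) — finding F-L2d2-1: printed
(d) fails for the divisor monoids `Φ₀(Y^log) ⊇ ∏_j ℤ_{≥0}` of [EtTh] §3 at coverings with infinitely
many special-fibre components, e.g. `Ÿ`, `Z_∞`) of three files of seat abc-iut-L1-d2 whose proofs use
only (a)(b)(c) and the definition of `M^rlf ⊆ M^rlf_factor` as "support dominated by some `b ∈ M^pf`":

* (`RealificationRPow.lean`, §`IsPerfFactorial.Rlf`) `IsPerfFactorialWeak.Rlf.rpow h r : M^rlf →* M^rlf`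
  — `M^rlf` is stable under the componentwise powers `a ↦ a^r`, `r ∈ ℝ_{≥0}` (supports are preserved) —
  with its laws, `root_eq_rpow`, injectivity, order properties, `dvd_iff_apply_le`;
* (`RlfHomEquivariant.lean`) `IsPerfFactorialWeak.Rlf.map_rpow`: EVERY homomorphism `φ : M^rlf → N^rlf`
  (`M`, `N` weakly perf-factorial) commutes with the powers `a ↦ a^r` (rational powers are algebraic;
  real powers are pinched between rational ones in the pointwise order of real numbers);
* (`RealificationDataCanonical.lean`, §`IsPerfFactorial.Rlf`) `IsPerfFactorialWeak.Rlf.realSMul h r :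
  (M^rlf)^gp →* (M^rlf)^gp` — the `ℝ`-vector-space structure of `(M^rlf)^gp` (by the generic
  `RealAction.gpSMul`), its laws, and `ℝ`-linearity `map_realSMul` of `φ^gp` for every `φ : M^rlf → N^rlf`.

Same declaration names under the weak namespace (`IsPerfFactorial.Rlf.X ↦ IsPerfFactorialWeak.Rlf.X`),
so consumers re-target by changing the hypothesis only; for a perf-factorial `M` the weak objects ARE the
printed ones (`h.weak.realification = h.realification` by `rfl`, `RealificationOrderWeak.lean`).  Builds
on abc-iut-L2-d2's `RlfStructureWeak.lean` (weak `coe_*`, `root`, `isPerfect`, `dvd_iff`).  No statement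
of the paper is re-typed or strengthened: constructions/verifications inside Def. 2.4 (i).
Seat abc-iut-L6-t12 (cell abc-iut; F-L2d2-1, F-L2d2-2 repair chain, split with abc-iut-L2-d2 2026-08-26T03:42Z,
piece (C)), toward the weak twins of `RealificationFunctor` / `RealificationData.canonical` / [EtTh]
Def. 3.6 (i) `RealifiedDivisorMonoids.ofRlfZ`.  HONEST FRAMING: classical monoid algebra; nothing here
bears on [IUTchIII] Cor. 3.12.
-/

noncomputable section

namespace Literature.AlgebraicGeometry.Frobenioids

open Function

universe u

/-! ### Two real-number facts (folklore; the private lemmas of `RlfHomEquivariant.lean`, re-proved) -/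

/-- Between two reals `0 ≤ a < b` there is a fraction `m/n` of natural numbers. [folklore] -/
private theorem exists_nat_div_btwn {a b : ℝ} (ha : 0 ≤ a) (hab : a < b) :
    ∃ m n : ℕ, 0 < n ∧ a < (m : ℝ) / n ∧ (m : ℝ) / n < b := by
  obtain ⟨q, haq, hqb⟩ := exists_rat_btwn hab
  have hq0 : (0 : ℚ) ≤ q := by
    have h0 : ((0 : ℚ) : ℝ) ≤ (q : ℝ) := by
      rw [Rat.cast_zero]
      exact ha.trans haq.le
    exact_mod_cast h0
  have hnum : 0 ≤ q.num := Rat.num_nonneg.mpr hq0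
  have hcast : ((q.num.toNat : ℕ) : ℝ) / (q.den : ℝ) = (q : ℝ) := by
    rw [← Int.cast_natCast, Int.toNat_of_nonneg hnum, Rat.cast_def]
  exact ⟨q.num.toNat, q.den, q.den_pos, by rw [hcast]; exact haq, by rw [hcast]; exact hqb⟩

/-- Pinching in `ℝ_{≥0}`: if `(m/n) · Y ≤ Z` for all fractions `m/n ≤ r` and `Z ≤ (m/n) · Y` for all
fractions `m/n ≥ r`, then `Z = r · Y`. [folklore] -/
private theorem eq_mul_of_pinch {r Y Z : NNReal}
    (hlo : ∀ m n : ℕ, 0 < n → (m : NNReal) / n ≤ r → (m : NNReal) / n * Y ≤ Z)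
    (hhi : ∀ m n : ℕ, 0 < n → r ≤ (m : NNReal) / n → Z ≤ (m : NNReal) / n * Y) : Z = r * Y := by
  have hlo' : ∀ m n : ℕ, 0 < n → (m : ℝ) / n ≤ (r : ℝ) → (m : ℝ) / n * (Y : ℝ) ≤ (Z : ℝ) :=
    fun m n hn hle => by
      have h1 := hlo m n hn (by exact_mod_cast hle)
      exact_mod_cast h1
  have hhi' : ∀ m n : ℕ, 0 < n → (r : ℝ) ≤ (m : ℝ) / n → (Z : ℝ) ≤ (m : ℝ) / n * (Y : ℝ) :=
    fun m n hn hle => by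
      have h1 := hhi m n hn (by exact_mod_cast hle)
      exact_mod_cast h1
  have hr : (0 : ℝ) ≤ r := r.2
  have hY : (0 : ℝ) ≤ Y := Y.2
  have hZ : (0 : ℝ) ≤ Z := Z.2
  apply NNReal.coe_injective
  rw [NNReal.coe_mul]
  refine le_antisymm ?_ ?_
  · by_contra hlt
    rw [not_le] at hlt
    rcases eq_or_lt_of_le hY with hY0 | hYpos
    · obtain ⟨m, n, hn, hrm, -⟩ := exists_nat_div_btwn hr (lt_add_one (r : ℝ))
      have h1 := hhi' m n hn hrm.le
      rw [← hY0, mul_zero] at h1 hlt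
      exact absurd (hlt.trans_le h1) (lt_irrefl _)
    · obtain ⟨m, n, hn, hrm, hmZ⟩ := exists_nat_div_btwn hr ((lt_div_iff₀ hYpos).mpr hlt)
      have h1 := hhi' m n hn hrm.le
      exact absurd (h1.trans_lt ((lt_div_iff₀ hYpos).mp hmZ)) (lt_irrefl _)
  · by_contra hlt
    rw [not_le] at hlt
    have hYpos : (0 : ℝ) < Y := by
      rcases eq_or_lt_of_le hY with hY0 | hYpos
      · rw [← hY0, mul_zero] at hlt
        exact absurd hlt (not_lt.mpr hZ)
      · exact hYpos
    obtain ⟨m, n, hn, hZm, hmr⟩ :=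
      exists_nat_div_btwn (div_nonneg hZ hY) ((div_lt_iff₀ hYpos).mpr hlt)
    have h1 := hlo' m n hn hmr.le
    exact absurd (((div_lt_iff₀ hYpos).mp hZm).trans_le h1) (lt_irrefl _)

/-! ### The powers `a^r` on the realification `M^rlf` of a weakly perf-factorial monoid -/

namespace IsPerfFactorialWeak

variable {M : Type u} [CommMonoid M]

/-- `M^rlf ⊆ M^rlf_factor` (weak `M`) is stable under the powers `a ↦ a^r` (supports are preserved).
[cite: MochizukiFrdI2008, Def. 2.4(i) p.48] -/
theorem rpow_mem (h : IsPerfFactorialWeak M) (r : NNReal) (a : h.Rlf) :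
    RlfFactor.rpow r (a : RlfFactor M) ∈ h.realification := by
  obtain ⟨b, hb⟩ := a.2
  exact ⟨b, (supp_rpow_subset r _).trans hb⟩

namespace Rlf

/-- **The power `a ↦ a^r` on `M^rlf`** (weak `M`), `r ∈ ℝ_{≥0}`: the `ℝ_{≥0}`-semimodule structure of the
realification whose groupification is the `ℝ`-vector space `(M^rlf)^gp` of Def. 2.4 (i) p. 48.
[cite: MochizukiFrdI2008, Def. 2.4(i) p.48] -/
def rpow (h : IsPerfFactorialWeak M) (r : NNReal) : h.Rlf →* h.Rlf :=
  ((RlfFactor.rpow r).comp h.realification.subtype).codRestrict _ fun a => h.rpow_mem r a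

/-- Components of `a^r` in `M^rlf`. [cite: MochizukiFrdI2008, Def. 2.4(i) p.48] -/
@[simp] theorem coe_rpow (h : IsPerfFactorialWeak M) (r : NNReal) (a : h.Rlf) :
    ((rpow h r a : h.Rlf) : RlfFactor M) = RlfFactor.rpow r (a : RlfFactor M) := rfl

/-- `a^0 = 1` in `M^rlf`. [cite: MochizukiFrdI2008, Def. 2.4(i) p.48] -/
@[simp] theorem rpow_zero (h : IsPerfFactorialWeak M) (a : h.Rlf) : rpow h 0 a = 1 :=
  Subtype.ext (by rw [coe_rpow, RlfFactor.rpow_zero, coe_one])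

/-- `a^1 = a` in `M^rlf`. [cite: MochizukiFrdI2008, Def. 2.4(i) p.48] -/
@[simp] theorem rpow_one (h : IsPerfFactorialWeak M) (a : h.Rlf) : rpow h 1 a = a :=
  Subtype.ext (by rw [coe_rpow, RlfFactor.rpow_one])

/-- `a^{r+r'} = a^r · a^{r'}` in `M^rlf`. [cite: MochizukiFrdI2008, Def. 2.4(i) p.48] -/
theorem rpow_add (h : IsPerfFactorialWeak M) (r r' : NNReal) (a : h.Rlf) :
    rpow h (r + r') a = rpow h r a * rpow h r' a :=
  Subtype.ext (by rw [coe_rpow, coe_mul, coe_rpow, coe_rpow, RlfFactor.rpow_add])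

/-- `a^{r r'} = (a^{r'})^r` in `M^rlf`. [cite: MochizukiFrdI2008, Def. 2.4(i) p.48] -/
theorem rpow_mul (h : IsPerfFactorialWeak M) (r r' : NNReal) (a : h.Rlf) :
    rpow h (r * r') a = rpow h r (rpow h r' a) :=
  Subtype.ext (by rw [coe_rpow, coe_rpow, coe_rpow, RlfFactor.rpow_mul])

/-- The powers commute in `M^rlf`. [cite: MochizukiFrdI2008, Def. 2.4(i) p.48] -/
theorem rpow_comm (h : IsPerfFactorialWeak M) (r r' : NNReal) (a : h.Rlf) :
    rpow h r (rpow h r' a) = rpow h r' (rpow h r a) := by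
  rw [← rpow_mul, mul_comm, rpow_mul]

/-- `a^n`, `n ∈ ℕ`, is the `n`-th power in `M^rlf`. [cite: MochizukiFrdI2008, Def. 2.4(i) p.48] -/
theorem rpow_natCast (h : IsPerfFactorialWeak M) (n : ℕ) (a : h.Rlf) : rpow h (n : NNReal) a = a ^ n :=
  Subtype.ext (by rw [coe_rpow, coe_pow, RlfFactor.rpow_natCast])

/-- `(a^{1/n})^n = a` in `M^rlf`: the `n`-th root of `RlfStructureWeak.lean` is `a^{1/n}`.
[cite: MochizukiFrdI2008, Def. 2.4(i) p.48] -/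
theorem root_eq_rpow (h : IsPerfFactorialWeak M) (n : ℕ+) (a : h.Rlf) :
    root h n a = rpow h ((n : ℕ) : NNReal)⁻¹ a :=
  Subtype.ext (funext fun 𝔮 => by
    rw [coe_rpow, RlfFactor.rpow_apply, ← Realification.root_eq_rpow]; rfl)

/-- For `r ≠ 0`, `a ↦ a^r` is injective on `M^rlf`. [cite: MochizukiFrdI2008, Def. 2.4(i) p.48] -/
theorem rpow_injective (h : IsPerfFactorialWeak M) {r : NNReal} (hr : r ≠ 0) :
    Injective (rpow h r) := by
  intro a b hab
  have h' := congrArg (rpow h r⁻¹) hab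
  rwa [← rpow_mul, ← rpow_mul, inv_mul_cancel₀ hr, rpow_one, rpow_one] at h'

/-- `a^r = 1` in `M^rlf` iff `r = 0` or `a = 1`. [cite: MochizukiFrdI2008, Def. 2.4(i) p.48] -/
theorem rpow_eq_one_iff (h : IsPerfFactorialWeak M) (r : NNReal) (a : h.Rlf) :
    rpow h r a = 1 ↔ r = 0 ∨ a = 1 := by
  by_cases hr : r = 0
  · subst hr
    simp only [rpow_zero, true_or]
  · simp only [hr, false_or]
    constructor
    · intro h1
      exact rpow_injective h hr (by rw [h1, map_one])
    · rintro rfl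
      exact map_one _

/-- The powers are monotone in the exponent on `M^rlf`: `r ≤ r' ⇒ a^r ∣ a^{r'}`.
[cite: MochizukiFrdI2008, Def. 2.4(i) p.48] -/
theorem rpow_dvd_rpow_of_le (h : IsPerfFactorialWeak M) {r r' : NNReal} (hrr' : r ≤ r') (a : h.Rlf) :
    rpow h r a ∣ rpow h r' a := by
  obtain ⟨d, rfl⟩ := exists_add_of_le hrr'
  rw [rpow_add]
  exact dvd_mul_right _ _

/-- For `r ≠ 0`: `a^r ∣ b^r` in `M^rlf` iff `a ∣ b`. [cite: MochizukiFrdI2008, Def. 2.4(i) p.48] -/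
theorem rpow_dvd_rpow_iff (h : IsPerfFactorialWeak M) {r : NNReal} (hr : r ≠ 0) (a b : h.Rlf) :
    rpow h r a ∣ rpow h r b ↔ a ∣ b := by
  refine ⟨fun hab => ?_, fun hab => map_dvd _ hab⟩
  have h' := map_dvd (rpow h r⁻¹) hab
  rwa [← rpow_mul, ← rpow_mul, inv_mul_cancel₀ hr, rpow_one, rpow_one] at h'

/-- The order of `M^rlf` read on values: `a ∣ b` iff `a_𝔮(f) ≤ b_𝔮(f)` for every prime `𝔮` and every
`f ∈ (M^pf_𝔮)^∨` (componentwise order, `Rlf.dvd_iff`, and the pointwise order of each `M^rlf_𝔮`).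
[cite: MochizukiFrdI2008, Def. 2.4(i) p.48] -/
theorem dvd_iff_apply_le (h : IsPerfFactorialWeak M) (a b : h.Rlf) :
    a ∣ b ↔ ∀ 𝔮 f, Multiplicative.toAdd (((a : RlfFactor M) 𝔮).toHom f) ≤
      Multiplicative.toAdd (((b : RlfFactor M) 𝔮).toHom f) := by
  rw [dvd_iff]
  exact forall_congr' fun 𝔮 => Realification.dvd_iff_apply_le _ _

end Rlf

end IsPerfFactorialWeak

/-! ### Homomorphisms of weak realifications are automatically `ℝ_{≥0}`-linear -/

namespace IsPerfFactorialWeak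

namespace Rlf

variable {M : Type u} [CommMonoid M] {N : Type u} [CommMonoid N]

/-- `(a^{m/n})^n = a^m` in `M^rlf`: the power `a^{m/n}` is the (unique) `n`-th root of `a^m`.
[cite: MochizukiFrdI2008, Def. 2.4(i) p.48] -/
theorem rpow_div_pow (hM : IsPerfFactorialWeak M) (m : ℕ) {n : ℕ} (hn : 0 < n) (a : hM.Rlf) :
    rpow hM ((m : NNReal) / n) a ^ n = a ^ m := by
  have hn' : ((n : ℕ) : NNReal) ≠ 0 := Nat.cast_ne_zero.mpr hn.ne'
  rw [← rpow_natCast hM n, ← rpow_mul, mul_div_cancel₀ _ hn', rpow_natCast]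

/-- An element `y` of `M^rlf` with `y^n = a^m` IS `a^{m/n}` (`n`-th powers are injective).
[cite: MochizukiFrdI2008, Def. 2.4(i) p.48] -/
theorem eq_rpow_div_of_pow_eq (hM : IsPerfFactorialWeak M)
    (m : ℕ) {n : ℕ} (hn : 0 < n) {a y : hM.Rlf} (hy : y ^ n = a ^ m) :
    y = rpow hM ((m : NNReal) / n) a := by
  apply ((isPerfect hM).1 n hn).1
  dsimp only
  rw [hy, rpow_div_pow hM m hn]

/-- **A homomorphism `M^rlf → N^rlf` commutes with the rational powers `a ↦ a^{m/n}`** (they are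
determined algebraically). [cite: MochizukiFrdI2008, Def. 2.4(i) p.48] -/
theorem map_rpow_div (hM : IsPerfFactorialWeak M) (hN : IsPerfFactorialWeak N)
    (φ : hM.Rlf →* hN.Rlf) (m : ℕ) {n : ℕ} (hn : 0 < n) (a : hM.Rlf) :
    φ (rpow hM ((m : NNReal) / n) a) = rpow hN ((m : NNReal) / n) (φ a) :=
  eq_rpow_div_of_pow_eq hN m hn (by rw [← map_pow, rpow_div_pow hM m hn, map_pow])

/-- **Pinching in `N^rlf`.** If `y^{m/n} ≤ z` for all fractions `m/n ≤ r` and `z ≤ y^{m/n}` for all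
fractions `m/n ≥ r`, then `z = y^r`: the order of `N^rlf` is the pointwise order of real numbers
(`Rlf.dvd_iff_apply_le`), in which the fractions are dense. [cite: MochizukiFrdI2008, Def. 2.4(i) p.48] -/
theorem eq_rpow_of_pinch (hN : IsPerfFactorialWeak N) {r : NNReal} {y z : hN.Rlf}
    (hlo : ∀ m n : ℕ, 0 < n → (m : NNReal) / n ≤ r → rpow hN ((m : NNReal) / n) y ∣ z)
    (hhi : ∀ m n : ℕ, 0 < n → r ≤ (m : NNReal) / n → z ∣ rpow hN ((m : NNReal) / n) y) :
    z = rpow hN r y := by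
  apply Subtype.ext
  funext 𝔮
  refine Realification.ext' fun f => Multiplicative.toAdd.injective ?_
  rw [coe_rpow, RlfFactor.rpow_apply, Realification.toAdd_toHom_rpow]
  apply eq_mul_of_pinch
  · intro m n hn hle
    have h1 := (dvd_iff_apply_le hN _ _).mp (hlo m n hn hle) 𝔮 f
    rwa [coe_rpow, RlfFactor.rpow_apply, Realification.toAdd_toHom_rpow] at h1
  · intro m n hn hle
    have h1 := (dvd_iff_apply_le hN _ _).mp (hhi m n hn hle) 𝔮 f
    rwa [coe_rpow, RlfFactor.rpow_apply, Realification.toAdd_toHom_rpow] at h1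

/-- **Every monoid homomorphism `φ : M^rlf → N^rlf` (for weakly perf-factorial `M`, `N`) commutes with
the powers `a ↦ a^r`, `r ∈ ℝ_{≥0}`**: `φ(a^r) = φ(a)^r`.  (So `φ^gp` is `ℝ`-linear on the `ℝ`-vector
spaces `(M^rlf)^gp → (N^rlf)^gp` of Def. 2.4 (i); in particular the pull-backs of "the divisor monoid
`Φ^rlf`" of Prop. 5.3 are `ℝ`-linear.) [cite: MochizukiFrdI2008, Def. 2.4(i) p.48] -/
theorem map_rpow (hM : IsPerfFactorialWeak M) (hN : IsPerfFactorialWeak N) (φ : hM.Rlf →* hN.Rlf)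
    (r : NNReal) (a : hM.Rlf) :
    φ (rpow hM r a) = rpow hN r (φ a) := by
  apply eq_rpow_of_pinch hN
  · intro m n hn hle
    rw [← map_rpow_div hM hN φ m hn a]
    exact map_dvd φ (rpow_dvd_rpow_of_le hM hle a)
  · intro m n hn hle
    rw [← map_rpow_div hM hN φ m hn a]
    exact map_dvd φ (rpow_dvd_rpow_of_le hM hle a)

/-- The same for the composite homomorphisms: `φ ∘ (−)^r = (−)^r ∘ φ`. [cite: MochizukiFrdI2008, Def. 2.4(i) p.48] -/
theorem comp_rpow (hM : IsPerfFactorialWeak M) (hN : IsPerfFactorialWeak N) (φ : hM.Rlf →* hN.Rlf)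
    (r : NNReal) :
    φ.comp (rpow hM r) = (rpow hN r).comp φ :=
  MonoidHom.ext fun a => map_rpow hM hN φ r a

/-- An isomorphism `M^rlf ≅ N^rlf` commutes with the powers in both directions.
[cite: MochizukiFrdI2008, Def. 2.4(i) p.48] -/
theorem mulEquiv_symm_rpow (hM : IsPerfFactorialWeak M) (hN : IsPerfFactorialWeak N)
    (e : hM.Rlf ≃* hN.Rlf) (r : NNReal) (b : hN.Rlf) :
    e.symm (rpow hN r b) = rpow hM r (e.symm b) := by
  apply e.injective
  rw [MulEquiv.apply_symm_apply, ← MulEquiv.coe_toMonoidHom, map_rpow hM hN, MulEquiv.coe_toMonoidHom,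
    MulEquiv.apply_symm_apply]

/-- The form used downstream: `φ(a^r · b) = φ(a)^r · φ(b)`. [cite: MochizukiFrdI2008, Def. 2.4(i) p.48] -/
theorem map_rpow_mul (hM : IsPerfFactorialWeak M) (hN : IsPerfFactorialWeak N)
    (φ : hM.Rlf →* hN.Rlf) (r : NNReal) (a b : hM.Rlf) :
    φ (rpow hM r a * b) = rpow hN r (φ a) * φ b := by
  rw [map_mul, map_rpow hM hN]

/-! ### The `ℝ`-vector space `(M^rlf)^gp` (weak `M`) -/

/-- **`r • (−)` on `(M^rlf)^gp`**, `r ∈ ℝ` (weak `M`): `r • [a] = [a^{r⁺}] / [a^{r⁻}]` — the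
`ℝ`-vector-space structure of Def. 2.4 (i) p. 48 on the groupification of the realization.
[cite: MochizukiFrdI2008, Def. 2.4(i) p.48] -/
def realSMul (hM : IsPerfFactorialWeak M) (r : ℝ) :
    Algebra.GrothendieckGroup hM.Rlf →* Algebra.GrothendieckGroup hM.Rlf :=
  RealAction.gpSMul (rpow hM) r

/-- `r • [a] = [a^r]` for `r ≥ 0`: the `ℝ`-action extends the powers of `M^rlf`.
[cite: MochizukiFrdI2008, Def. 2.4(i) p.48] -/
theorem realSMul_coe_of (hM : IsPerfFactorialWeak M) (r : NNReal) (a : hM.Rlf) :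
    realSMul hM (r : ℝ) (Algebra.GrothendieckGroup.of a) = Algebra.GrothendieckGroup.of (rpow hM r a) :=
  RealAction.gpSMul_coe_of (rpow hM) (rpow_add hM) (rpow_zero hM) r a

/-- `r • [a] = [a^{r⁺}] / [a^{r⁻}]` (the defining formula). [cite: MochizukiFrdI2008, Def. 2.4(i) p.48] -/
theorem realSMul_of (hM : IsPerfFactorialWeak M) (r : ℝ) (a : hM.Rlf) :
    realSMul hM r (Algebra.GrothendieckGroup.of a) =
      Algebra.GrothendieckGroup.of (rpow hM r.toNNReal a) /
        Algebra.GrothendieckGroup.of (rpow hM (-r).toNNReal a) :=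
  RealAction.gpSMul_of (rpow hM) r a

/-- `(r + s) • ξ = (r • ξ)(s • ξ)`. [cite: MochizukiFrdI2008, Def. 2.4(i) p.48] -/
theorem realSMul_add (hM : IsPerfFactorialWeak M) (r s : ℝ) (ξ : Algebra.GrothendieckGroup hM.Rlf) :
    realSMul hM (r + s) ξ = realSMul hM r ξ * realSMul hM s ξ :=
  RealAction.gpSMul_add (rpow hM) (rpow_add hM) r s ξ

/-- `0 • ξ = 1`. [cite: MochizukiFrdI2008, Def. 2.4(i) p.48] -/
theorem realSMul_zero (hM : IsPerfFactorialWeak M) (ξ : Algebra.GrothendieckGroup hM.Rlf) :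
    realSMul hM 0 ξ = 1 :=
  RealAction.gpSMul_zero (rpow hM) (rpow_add hM) (rpow_zero hM) ξ

/-- `(−r) • ξ = (r • ξ)⁻¹`. [cite: MochizukiFrdI2008, Def. 2.4(i) p.48] -/
theorem realSMul_neg (hM : IsPerfFactorialWeak M) (r : ℝ) (ξ : Algebra.GrothendieckGroup hM.Rlf) :
    realSMul hM (-r) ξ = (realSMul hM r ξ)⁻¹ :=
  RealAction.gpSMul_neg (rpow hM) (rpow_add hM) r ξ

/-- `1 • ξ = ξ`. [cite: MochizukiFrdI2008, Def. 2.4(i) p.48] -/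
theorem realSMul_one (hM : IsPerfFactorialWeak M) (ξ : Algebra.GrothendieckGroup hM.Rlf) :
    realSMul hM 1 ξ = ξ :=
  RealAction.gpSMul_one (rpow hM) (rpow_add hM) (rpow_zero hM) (rpow_one hM) ξ

/-- `(r s) • ξ = r • (s • ξ)`. [cite: MochizukiFrdI2008, Def. 2.4(i) p.48] -/
theorem realSMul_mul (hM : IsPerfFactorialWeak M) (r s : ℝ) (ξ : Algebra.GrothendieckGroup hM.Rlf) :
    realSMul hM (r * s) ξ = realSMul hM r (realSMul hM s ξ) :=
  RealAction.gpSMul_mul (rpow hM) (rpow_add hM) (rpow_mul hM) r s ξ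

/-- **`φ^gp` is `ℝ`-linear for EVERY homomorphism `φ : M^rlf → N^rlf`** (`M`, `N` weakly perf-factorial):
`φ^gp(r • ξ) = r • φ^gp(ξ)` — by the automatic `ℝ_{≥0}`-equivariance of `φ` (`Rlf.map_rpow`).
[cite: MochizukiFrdI2008, Def. 2.4(i) p.48] -/
theorem map_realSMul (hM : IsPerfFactorialWeak M) (hN : IsPerfFactorialWeak N)
    (φ : hM.Rlf →* hN.Rlf) (r : ℝ) (ξ : Algebra.GrothendieckGroup hM.Rlf) :
    MonGp.map φ (realSMul hM r ξ) = realSMul hN r (MonGp.map φ ξ) :=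
  RealAction.monGpMap_gpSMul (rpow hM) (rpow hN) φ (fun r a => map_rpow hM hN φ r a) r ξ

/-- The same for any homomorphism `ψ : (M^rlf)^gp → (N^rlf)^gp` lying over some `φ : M^rlf → N^rlf`.
[cite: MochizukiFrdI2008, Def. 2.4(i) p.48] -/
theorem map_realSMul' (hM : IsPerfFactorialWeak M) (hN : IsPerfFactorialWeak N) (φ : hM.Rlf →* hN.Rlf)
    (ψ : Algebra.GrothendieckGroup hM.Rlf →* Algebra.GrothendieckGroup hN.Rlf)
    (hψ : ∀ a, ψ (Algebra.GrothendieckGroup.of a) = Algebra.GrothendieckGroup.of (φ a))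
    (r : ℝ) (ξ : Algebra.GrothendieckGroup hM.Rlf) : ψ (realSMul hM r ξ) = realSMul hN r (ψ ξ) :=
  RealAction.map_gpSMul (rpow hM) (rpow hN) φ (fun r a => map_rpow hM hN φ r a) ψ hψ r ξ

/-- Every element of `(M^rlf)^gp` is `[a] / [b]` with `a, b ∈ M^rlf` (so the `ℝ`-vector space
`(M^rlf)^gp` is generated by the image of `M^rlf`). [cite: MochizukiFrdI2008, Def. 2.4(i) p.48] -/
theorem gp_exists_eq_div (hM : IsPerfFactorialWeak M) (ξ : Algebra.GrothendieckGroup hM.Rlf) :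
    ∃ a b : hM.Rlf, ξ = Algebra.GrothendieckGroup.of a / Algebra.GrothendieckGroup.of b := by
  obtain ⟨⟨a, b⟩, hx⟩ := (Localization.monoidOf (⊤ : Submonoid hM.Rlf)).surj ξ
  exact ⟨a, b, eq_div_iff_mul_eq'.mpr hx⟩

/-- `n • ξ = ξ^n` (`n ∈ ℕ`): on `(M^rlf)^gp` the action of a natural number is the power.
[cite: MochizukiFrdI2008, Def. 2.4(i) p.48] -/
theorem realSMul_natCast (hM : IsPerfFactorialWeak M) (n : ℕ) (ξ : Algebra.GrothendieckGroup hM.Rlf) :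
    realSMul hM (n : ℝ) ξ = ξ ^ n := by
  induction n with
  | zero => rw [Nat.cast_zero, realSMul_zero, pow_zero]
  | succ k ih => rw [Nat.cast_succ, realSMul_add, ih, realSMul_one, pow_succ]

/-- `(1/n) • ξ^n = ξ` (`n ≥ 1`): the identity behind the root-closedness of `ℝ`-subspaces of
`(M^rlf)^gp`. [cite: MochizukiFrdI2008, Def. 2.4(i) p.48] -/
theorem realSMul_inv_natCast_pow (hM : IsPerfFactorialWeak M) {n : ℕ} (hn : 0 < n)
    (ξ : Algebra.GrothendieckGroup hM.Rlf) :
    realSMul hM ((n : ℝ)⁻¹) (ξ ^ n) = ξ := by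
  have hn' : (n : ℝ) ≠ 0 := Nat.cast_ne_zero.mpr hn.ne'
  rw [← realSMul_natCast hM n ξ, ← realSMul_mul, inv_mul_cancel₀ hn', realSMul_one]

end Rlf

end IsPerfFactorialWeak

end Literature.AlgebraicGeometry.Frobenioids

end
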